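import Summits.BirchSwinnertonDyer.BirchSwinnertonDyer.Theorems.ByReductionTypeAtTwoTowerClassKitE
import Summits.BirchSwinnertonDyer.BirchSwinnertonDyer.Theorems.ByReductionTypeAtTwoTowerLayerRank
import Literature.NumberTheory.DiophantineGeometry.LocalReductionHasAdditiveReductionAtProofs
import Literature.NumberTheory.EllipticCurves.Greenberg1999.NoProperFiniteIndexSubmoduleAdditive
import HarnessLib

/-!
# The `λ`-ROAD WITH RATIONAL `2`-TORSION: Greenberg Prop. 4.15 (i) (an ADDITIVE odd prime ⇒ `X(E/ℚ_∞)` has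
# no finite `Λ`-submodule, ANY torsion) + a torsion-tolerant RANK certificate ⇒ `λ(X) ≥ λ_an`, the `2`-adic
# IMC, both halves, `BSD(E,2)` and the descent inequality `MissingLowerBoundAt W 2` (item
# `OrdMissingLowerBoundAtTwo`, 19577) AT a curve with `E(ℚ)[2] ≠ 0` — NO descent certificate; the W-generic
# doors (route ByReductionTypeAtTwo, items 19577 / 19573 / 19271; seat bsd-2adic-ord-3 GEN 6)

HONEST FRAMING (cell `bsd-2adic`, run/shared/lean/pub/bsd-2adic/, HUMAN RULINGS D-0036 / D-0054 / D-0074): THEOREMS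
ONLY; nothing asserted; no definition; the ONE named fact consumed that is new to the Summits side is the
PUBLISHED Greenberg LNM 1716 Prop. 4.15 (i) (`Greenberg1999.prop415i_noFiniteSubmodule_of_additive`, binder
`h415`; §4 of the volume treats `p = 2` explicitly); closes nothing by itself; the `∀`-cruxes 19577 / 19573 /
19271 stay OPEN; BSD is not proved by any of this («closes rung K4 of BirchSwinnertonDyer» only when an OFFER
row is booked by the referee).

WHY THIS FILE. Every `λ`-road door in the tree (`KatoHalfPinch.le_lambda_of_towerGap_of_towerRank`,
`…_of_towerGap_of_layerSelmer`, the GEN 4/5 rows and ord-2's `…_lambdaRoad_A03` rows) needs `2 ∤ #E(ℚ)_tors`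
TWICE: (a) for Greenberg Prop. 4.14@2 (`X` has no finite `Λ`-submodule), (b) for the injectivity of
`h_j : H¹(ℚ_j, E[2^∞]) → H¹(ℚ_∞, E[2^∞])` behind the rank count `2^n ≤ #Sel_{2^∞}(E/ℚ_j)[2] ⇒ 2^n ≤ #X/(2,T^{2^j})X`.
On the 86 INELIG classes of the open X5@2 good-ordinary census (`E(ℚ)[2] ≠ 0` at every member) the
GAP side is already torsion-tolerant (ord-2 GEN 4 `TowerLayerTorsion` / KitD / KitE: pay with
`#ker h_j = #E[2^∞]^{Gal(ℚ̄/ℚ_j)}`), but the `λ`-side had «no printed no-finite-submodule input at `p = 2`»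
(ord-3 GEN 5 census: Prop. 4.14 needs odd torsion, Prop. 4.15 (ii) / Hachimori–Matsuno (ii) need `p ≥ 3`).
Prop. 4.15 (i) IS that input whenever `E` has an additive prime `v₀ ∤ 2` — 54 of the 86 INELIG classes
(`ℓ² ∣ N` for an odd `ℓ`). This file:
* §1 `le_lambda_of_towerGap_of_towerRank_of_additive` — `n ≤ λ(X)` from `TowerGapAtTwo W` + a RANK certificate
  `∃ j, 2^n ≤ #X/(2,T^j)X` + PRINT `h415` + an additive place `v ∤ 2` of `W`; NO torsion hypothesis.
* §2 the torsion-tolerant RANK certificates (any `E(ℚ)_tors`, granted the finiteness of `E(ℚ_∞)[2^∞]` = PRINT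
  `hB`, `Greenberg1999.finite_torsion_cyclotomicZpExtension`): `2^{n+t} ≤ #Sel_{2^∞}(E/ℚ_j)[2]` or
  `2^{n+t} ≤ #A_j[2]` with `#E[2^∞]^{Gal(ℚ̄/ℚ_j)} ≤ 2^t` ⇒ `2^n ≤ #X/(2,T^{2^j})X`
  (`#Sel_j[2], #A_j[2] ≤ #ker h_j · #T_j`, `#T_j = #X/(2,T^{2^j})X`, `#ker h_j = #E[2^∞]^{Gal(ℚ̄/ℚ_j)}` — ord-2's
  `TowerLayer.natCard_selmerLayer_pTorsion_le_mul` / `natCard_layerClasses_le_mul`); layer-`0` forms with the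
  torsion certificate read off a good odd prime `ℓ` (`#Ẽ(𝔽_ℓ) = m`, `¬ 2^{t+1} ∣ m`, KitD).
* §3 the doors AT `W` (`hper₀` displayed, as on every INELIG row): `MazurMainConjecture W 2`, the Kato–Néron
  half (items 19271 / 19573 at `W`), the Eisenstein half, `BSDp W 2` and `MissingLowerBoundAt W 2` (item 19577
  at `W`) from PRINT {`h17`, `h415`, `hB`; at rank 0 `hEC`, `hmod`, `hGZK`} + {additive place, `GoodOrd W 2`} +
  CERT {gap, rank, `λ_an = n`, `μ_an = 0`} — no `hShaAn`, no `hdvd`, no `h414`, no odd torsion.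
* §4 an integer-model criterion for an additive place off `2` (`ℓ ∣ Δ`, `ℓ ∣ c₄`, `ℓ⁴ ∤ c₄`; Silverman
  VII.5.1 (c) + VII.1.1), the shape the class rows feed to `hadd`. The first two INELIG `λ`-road ROWS
  (**102225t1**, **360555n1**) are the companion file `Theorems/ByReductionTypeAtTwoTowerLambdaRankAdditiveRows.lean`.
HABITAT today (layer-0 rank certificate `e₀ − t₀ ≥ λ_an + 1` under the engineer's reading `#A_0[2] = 2^{e₀ − t₀}`,
tower-eng TABLE-TOWER-E1): 11 INELIG classes (102225t 141225i 159471f 240185f 395967r 413345c 299775b 462441s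
312939c 360555n 117925d); RESIDUE named: **469737k1** (`#Ш_an = 64`, additive at `3`): `e₀ − t₀ = 4 = λ_an`, one
bit short at layer 0; a layer-`j ≥ 1` torsion certificate (`#E(ℚ_j)[2^∞] ≤ 2^t` over the abstract layer field)
is not kernel-cheap today.
References: [GreenbergLNM1716] §1 p. 60/62, §3 pp. 85–86, Thm. 4.1, Lemma 4.3, Prop. 4.15 (i); [Kato2004Asterisque]
Thm. 17.4; [SilvermanAEC2009] VII.1 Rem. 1.1, VII.3 Prop. 3.1 (b), VII.5 Prop. 5.1 (c); [Washington1997] §13.2;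
[Miller2011LMS] Def. 1.1.
-/

set_option autoImplicit false
-- the sub-problem namespace repeats the summit name by design (D-0017 nested layout)
set_option linter.dupNamespace false

noncomputable section

open scoped Classical MatrixGroups ModularForm

open NumberField IsDedekindDomain CongruenceSubgroup WeierstrassCurve Literature.NumberTheory.EllipticCurves
  Literature.NumberTheory.EllipticCurves.ModularForms Literature.NumberTheory.EllipticCurves.Rank1Residual
  Literature.NumberTheory.EllipticCurves.Rank1Residual.Typed
  Literature.NumberTheory.EllipticCurves.Greenberg1999
  Summit.BirchSwinnertonDyer.Rank1Residual.X1.MuLambda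
  Summit.BirchSwinnertonDyer.Rank1Residual.X1.MuPart
  Summit.BirchSwinnertonDyer.Rank1Residual.X1.ParitySqueeze
  Summit.BirchSwinnertonDyer.BirchSwinnertonDyer.Theorems.Rank1ResidualX1Defs
  Summit.BirchSwinnertonDyer.Rank1Residual.X5 Summit.BirchSwinnertonDyer.Rank1Residual.X5.O1
  Summit.BirchSwinnertonDyer.Rank1Residual.X5.TowerGap Summit.BirchSwinnertonDyer.Rank1Residual
  Summit.BirchSwinnertonDyer.BirchSwinnertonDyer.Theorems
  Summit.BirchSwinnertonDyer.BirchSwinnertonDyer.Theorems.KatoHalfPinch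

namespace Summit.BirchSwinnertonDyer.BirchSwinnertonDyer.Theorems.TowerLambdaTorsion

variable (W : WeierstrassCurve ℚ) [W.IsElliptic] [W.IsGloballyMinimal]

/-! ## §1 `n ≤ λ(X)` with Prop. 4.15 (i) in place of Prop. 4.14 — no torsion hypothesis -/

/-- **`n ≤ λ(X(E/ℚ_∞))` from finite-layer data, ANY `E(ℚ)_tors`.** PUBLISHED Greenberg 1999 Prop. 4.15 (i)
(`h415`: an additive place `v ∤ p` and `X` torsion ⇒ no nonzero finite `Λ`-submodule) + an additive place
`v ∤ 2` of `W` + certificates `TowerGapAtTwo W` (⟺ `X` torsion ∧ `μ(X) = 0`) and the RANK certificate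
`∃ j, 2^n ≤ #X/(2,T^j)X` for every cyclotomic datum (`hrank`) ⇒ `n ≤ λ(X)`.
[cite: GreenbergLNM1716, Prop. 4.15 (i) (§4)] [cite: Washington1997, §13.2] -/
theorem le_lambda_of_towerGap_of_towerRank_of_additive (h415 : prop415i_noFiniteSubmodule_of_additive)
    (hadd : ∃ v : HeightOneSpectrum (𝓞 ℚ), ((2 : ℕ) : 𝓞 ℚ) ∉ v.asIdeal ∧ W.HasAdditiveReductionAt v)
    (hgap : TowerGapAtTwo W) {n : ℕ}
    (hrank : ∀ (κ : ZpExtension ℚ 2) (γ : Field.absoluteGaloisGroup ℚ), κ.IsCyclotomic →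
      κ.IsTopGenerator γ → IsCyclotomicVariable 2 γ → ∀ D : W.SelmerDualData κ γ,
      ∃ j : ℕ, 2 ^ n ≤ Nat.card (D.X ⧸ (towerIdeal 2 j • ⊤ : Submodule (IwasawaAlgebra 2) D.X)))
    (κ : ZpExtension ℚ 2) (γ : Field.absoluteGaloisGroup ℚ) (hκ : κ.IsCyclotomic)
    (hγ : κ.IsTopGenerator γ) (hγ' : IsCyclotomicVariable 2 γ) (D : W.SelmerDualData κ γ) :
    n ≤ D.lambda := by
  haveI : Module.Finite (IwasawaAlgebra 2) D.X := D.module_finite_holds hγ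
  obtain ⟨hX, hμ⟩ := isTorsion_and_mu_eq_zero_of_towerGapAtTwo W hgap hκ hγ hγ' D
  obtain ⟨j, hj⟩ := hrank κ γ hκ hγ hγ' D
  exact le_lambdaInvariant_of_pow_le_natCard_quotient_towerIdeal 2 hX hμ
    (fun N hN => h415 W 2 hadd κ γ hκ hγ D hX N hN) hj

/-! ## §2 The RANK certificate with rational `2`-torsion: pay with `#ker h_j = #E[2^∞]^{Gal(ℚ̄/ℚ_j)}` -/

omit [W.IsGloballyMinimal] in
/-- **RANK certificate, `Sel`-currency, any torsion.** Granted the finiteness of `E(ℚ_∞)[2^∞]` (`hB`, per `κ`):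
`#E[2^∞]^{Gal(ℚ̄/ℚ_j)} ≤ 2^t` and `2^{n+t} ≤ #Sel_{2^∞}(E/ℚ_j)[2]` ⇒ for every cyclotomic datum
`2^n ≤ #X/(2,T^{2^j})X` (`#Sel_j[2] ≤ #ker h_j · #T_j`, `#T_j = #X/(2,ω_j)X`, `#ker h_j = #E[2^∞]^{Gal(ℚ̄/ℚ_j)}`).
[cite: GreenbergLNM1716, §1 p. 60 and p. 62, §3 pp. 85–86, §4 Lemma 4.3] -/
theorem towerRank_of_layerSelmer_of_torsion
    (hB : ∀ κ : ZpExtension ℚ 2, κ.IsCyclotomic →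
      Finite (FixedPoints.addSubgroup κ.kerSubgroup (geomPrimaryTorsion W 2)))
    {j n t : ℕ}
    (htor : ∀ κ : ZpExtension ℚ 2, κ.IsCyclotomic →
      Nat.card {m : geomPrimaryTorsion W 2 | ∀ σ ∈ κ.layerSubgroup j, σ • m = m} ≤ 2 ^ t)
    (hsel : ∀ κ : ZpExtension ℚ 2, κ.IsCyclotomic →
      2 ^ (n + t) ≤ Nat.card {z : W.selmerLayer κ j // 2 • z = 0}) :
    ∀ (κ : ZpExtension ℚ 2) (γ : Field.absoluteGaloisGroup ℚ), κ.IsCyclotomic →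
      κ.IsTopGenerator γ → IsCyclotomicVariable 2 γ → ∀ D : W.SelmerDualData κ γ,
      ∃ j' : ℕ, 2 ^ n ≤ Nat.card (D.X ⧸ (towerIdeal 2 j' • ⊤ : Submodule (IwasawaAlgebra 2) D.X)) := by
  intro κ γ hκ hγ _ D
  haveI : Module.Finite (IwasawaAlgebra 2) D.X := D.module_finite_holds hγ
  haveI := hB κ hκ
  have hfinj : Finite (W.layerToInfty κ j).ker := TowerLayer.finite_ker_layerToInfty W κ j
  have hTj : Finite {s : W.selmerInfty κ // 2 • s = 0 ∧
      W.conjH1 2 κ.kerSubgroup (γ ^ 2 ^ j) (s : W.subgroupH1 2 κ.kerSubgroup) = s} :=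
    TowerLayer.finite_fixedPTorsion D j
  refine ⟨2 ^ j, ?_⟩
  rw [← KatoHalfPinch.layerIdeal_eq_towerIdeal, TowerLayer.natCard_quotient_layerIdeal_eq D j]
  have hK : Nat.card (W.layerToInfty κ j).ker ≤ 2 ^ t := by
    rw [W.natCard_ker_layerToInfty_eq_natCard_fixedPoints κ j]; exact htor κ hκ
  have h1 : 2 ^ n * 2 ^ t ≤ 2 ^ t * Nat.card {s : W.selmerInfty κ // 2 • s = 0 ∧
      W.conjH1 2 κ.kerSubgroup (γ ^ 2 ^ j) (s : W.subgroupH1 2 κ.kerSubgroup) = s} := by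
    rw [← pow_add]
    exact (hsel κ hκ).trans ((TowerLayer.natCard_selmerLayer_pTorsion_le_mul W κ γ j hfinj hTj).trans
      (Nat.mul_le_mul_right _ hK))
  rw [mul_comm] at h1
  exact Nat.le_of_mul_le_mul_left h1 (by positivity)

omit [W.IsGloballyMinimal] in
/-- **RANK certificate, `A`-currency, any torsion.** Granted the finiteness of `E(ℚ_∞)[2^∞]` (`hB`, per `κ`):
`#E[2^∞]^{Gal(ℚ̄/ℚ_j)} ≤ 2^t` and `2^{n+t} ≤ #A_j[2]` (`A_j = h_j⁻¹(Sel_{2^∞}(E/ℚ_∞))`) ⇒ for every cyclotomic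
datum `2^n ≤ #X/(2,T^{2^j})X` (`#A_j[2] ≤ #ker h_j · #T_j`, ord-2's KitE).
[cite: GreenbergLNM1716, §1 p. 60 and p. 62, §3 pp. 85–86, §4 Lemma 4.3] -/
theorem towerRank_of_layerClasses_of_torsion
    (hB : ∀ κ : ZpExtension ℚ 2, κ.IsCyclotomic →
      Finite (FixedPoints.addSubgroup κ.kerSubgroup (geomPrimaryTorsion W 2)))
    {j n t : ℕ}
    (htor : ∀ κ : ZpExtension ℚ 2, κ.IsCyclotomic →
      Nat.card {m : geomPrimaryTorsion W 2 | ∀ σ ∈ κ.layerSubgroup j, σ • m = m} ≤ 2 ^ t)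
    (hlow : ∀ κ : ZpExtension ℚ 2, κ.IsCyclotomic →
      2 ^ (n + t) ≤ Nat.card {z : W.selmerInftyPreimage κ j // 2 • z = 0}) :
    ∀ (κ : ZpExtension ℚ 2) (γ : Field.absoluteGaloisGroup ℚ), κ.IsCyclotomic →
      κ.IsTopGenerator γ → IsCyclotomicVariable 2 γ → ∀ D : W.SelmerDualData κ γ,
      ∃ j' : ℕ, 2 ^ n ≤ Nat.card (D.X ⧸ (towerIdeal 2 j' • ⊤ : Submodule (IwasawaAlgebra 2) D.X)) := by
  intro κ γ hκ hγ _ D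
  haveI : Module.Finite (IwasawaAlgebra 2) D.X := D.module_finite_holds hγ
  haveI := hB κ hκ
  have hfinj : Finite (W.layerToInfty κ j).ker := TowerLayer.finite_ker_layerToInfty W κ j
  have hTj : Finite {s : W.selmerInfty κ // 2 • s = 0 ∧
      W.conjH1 2 κ.kerSubgroup (γ ^ 2 ^ j) (s : W.subgroupH1 2 κ.kerSubgroup) = s} :=
    TowerLayer.finite_fixedPTorsion D j
  refine ⟨2 ^ j, ?_⟩
  rw [← KatoHalfPinch.layerIdeal_eq_towerIdeal, TowerLayer.natCard_quotient_layerIdeal_eq D j]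
  have hK : Nat.card (W.layerToInfty κ j).ker ≤ 2 ^ t := by
    rw [W.natCard_ker_layerToInfty_eq_natCard_fixedPoints κ j]; exact htor κ hκ
  have h1 : 2 ^ n * 2 ^ t ≤ 2 ^ t * Nat.card {s : W.selmerInfty κ // 2 • s = 0 ∧
      W.conjH1 2 κ.kerSubgroup (γ ^ 2 ^ j) (s : W.subgroupH1 2 κ.kerSubgroup) = s} := by
    rw [← pow_add]
    exact (hlow κ hκ).trans ((TowerLayer.natCard_layerClasses_le_mul W κ γ j hfinj hTj).trans
      (Nat.mul_le_mul_right _ hK))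
  rw [mul_comm] at h1
  exact Nat.le_of_mul_le_mul_left h1 (by positivity)

omit [W.IsGloballyMinimal] in
/-- **RANK certificate at layer `0`, `A`-currency, with PRINT `hB` and the torsion certificate
`#E[2^∞]^{Γ_ℚ} ≤ 2^t`.** [cite: GreenbergLNM1716, §1 p. 60 and p. 62, §3 pp. 85–86, §4 Lemma 4.3] -/
theorem towerRank_of_layerClasses_of_torsion_zero (hB : Greenberg1999.finite_torsion_cyclotomicZpExtension)
    {n t : ℕ}
    (htor : Nat.card (MulAction.fixedPoints (Field.absoluteGaloisGroup ℚ) (geomPrimaryTorsion W 2)) ≤ 2 ^ t)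
    (hlow : ∀ κ : ZpExtension ℚ 2, κ.IsCyclotomic →
      2 ^ (n + t) ≤ Nat.card {z : W.selmerInftyPreimage κ 0 // 2 • z = 0}) :
    ∀ (κ : ZpExtension ℚ 2) (γ : Field.absoluteGaloisGroup ℚ), κ.IsCyclotomic →
      κ.IsTopGenerator γ → IsCyclotomicVariable 2 γ → ∀ D : W.SelmerDualData κ γ,
      ∃ j' : ℕ, 2 ^ n ≤ Nat.card (D.X ⧸ (towerIdeal 2 j' • ⊤ : Submodule (IwasawaAlgebra 2) D.X)) :=
  towerRank_of_layerClasses_of_torsion W (fun κ hκ ↦ hB W 2 κ hκ) (j := 0)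
    (fun κ _ ↦ by rw [W.natCard_fixedBy_layerSubgroup_zero_eq κ]; exact htor) hlow

/-- **RANK certificate at layer `0`, `A`-currency, torsion certificate = a decidable point count** at a good
odd prime `ℓ ≥ 3` (`#Ẽ(𝔽_ℓ) = m`, `¬ 2^{t+1} ∣ m`, so `#E[2^∞]^{Γ_ℚ} ≤ 2^{ord₂ #E(ℚ)_tors} ≤ 2^t`, KitD).
[cite: SilvermanAEC2009, VII.3 Prop. 3.1(b)] [cite: GreenbergLNM1716, §1 p. 62, §3 pp. 85–86, §4 Lemma 4.3] -/
theorem towerRank_of_layerClasses_of_goodPrime_card (hB : Greenberg1999.finite_torsion_cyclotomicZpExtension)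
    {n t m : ℕ} (ℓ : ℕ) [Fact ℓ.Prime] (h3 : 3 ≤ ℓ) (hgood : W.HasGoodReductionAtPrime ℓ)
    (hm : W.reductionPointCount ℓ = m) (hndvd : ¬ 2 ^ (t + 1) ∣ m)
    (hlow : ∀ κ : ZpExtension ℚ 2, κ.IsCyclotomic →
      2 ^ (n + t) ≤ Nat.card {z : W.selmerInftyPreimage κ 0 // 2 • z = 0}) :
    ∀ (κ : ZpExtension ℚ 2) (γ : Field.absoluteGaloisGroup ℚ), κ.IsCyclotomic →
      κ.IsTopGenerator γ → IsCyclotomicVariable 2 γ → ∀ D : W.SelmerDualData κ γ,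
      ∃ j' : ℕ, 2 ^ n ≤ Nat.card (D.X ⧸ (towerIdeal 2 j' • ⊤ : Submodule (IwasawaAlgebra 2) D.X)) := by
  haveI : NeZero ℓ := ⟨(Fact.out : ℓ.Prime).ne_zero⟩
  have hm0 : m ≠ 0 := hm ▸ (reductionPointCount_pos W ℓ).ne'
  exact towerRank_of_layerClasses_of_torsion_zero W hB
    (TowerClass.natCard_fixedPoints_geomPrimaryTorsion_le_pow_of_good W 2 ℓ h3 hgood
      (hm ▸ TowerClass.padicValNat_le_of_not_pow_succ_dvd hm0 hndvd)) hlow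

/-- **RANK certificate at layer `0`, `Sel`-currency, torsion certificate from a good odd prime.**
[cite: SilvermanAEC2009, VII.3 Prop. 3.1(b)] [cite: GreenbergLNM1716, §1 p. 62, §3 pp. 85–86, §4 Lemma 4.3] -/
theorem towerRank_of_layerSelmer_of_goodPrime_card (hB : Greenberg1999.finite_torsion_cyclotomicZpExtension)
    {n t m : ℕ} (ℓ : ℕ) [Fact ℓ.Prime] (h3 : 3 ≤ ℓ) (hgood : W.HasGoodReductionAtPrime ℓ)
    (hm : W.reductionPointCount ℓ = m) (hndvd : ¬ 2 ^ (t + 1) ∣ m)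
    (hsel : ∀ κ : ZpExtension ℚ 2, κ.IsCyclotomic →
      2 ^ (n + t) ≤ Nat.card {z : W.selmerLayer κ 0 // 2 • z = 0}) :
    ∀ (κ : ZpExtension ℚ 2) (γ : Field.absoluteGaloisGroup ℚ), κ.IsCyclotomic →
      κ.IsTopGenerator γ → IsCyclotomicVariable 2 γ → ∀ D : W.SelmerDualData κ γ,
      ∃ j' : ℕ, 2 ^ n ≤ Nat.card (D.X ⧸ (towerIdeal 2 j' • ⊤ : Submodule (IwasawaAlgebra 2) D.X)) := by
  haveI : NeZero ℓ := ⟨(Fact.out : ℓ.Prime).ne_zero⟩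
  have hm0 : m ≠ 0 := hm ▸ (reductionPointCount_pos W ℓ).ne'
  refine towerRank_of_layerSelmer_of_torsion W (fun κ hκ ↦ hB W 2 κ hκ) (j := 0) (fun κ _ ↦ ?_) hsel
  rw [W.natCard_fixedBy_layerSubgroup_zero_eq κ]
  exact TowerClass.natCard_fixedPoints_geomPrimaryTorsion_le_pow_of_good W 2 ℓ h3 hgood
    (hm ▸ TowerClass.padicValNat_le_of_not_pow_succ_dvd hm0 hndvd)

/-! ## §3 The doors AT `W` — rational `2`-torsion allowed, `hper₀` displayed, no descent certificate -/

/-- **Door: `MazurMainConjecture W 2` with rational `2`-torsion allowed.** PRINT {Kato 17.4 (1)(2)@2,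
Greenberg Prop. 4.15 (i)} + an additive place `v ∤ 2` + DISPLAYED `hper₀` + `GoodOrd W 2` + certificates
{`TowerGapAtTwo W`, RANK `hrank`, `λ_an = n`, `μ_an = 0`} — any analytic rank, any residual image, any torsion.
[cite: Kato2004Asterisque, Thm. 17.4 (1)(2) (p. 273)] [cite: GreenbergLNM1716, Prop. 4.15 (i) (§4)] -/
theorem mazurMainConjecture_two_of_towerGap_of_towerRank_of_additive
    (h17 : ∀ [NeZero (W.conductorNorm ℤ)] (f : CuspForm (Gamma0 (W.conductorNorm ℤ)) 2),
      kato_divisibility_allPrimes W 2 (f := f))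
    (h415 : prop415i_noFiniteSubmodule_of_additive)
    (hadd : ∃ v : HeightOneSpectrum (𝓞 ℚ), ((2 : ℕ) : 𝓞 ℚ) ∉ v.asIdeal ∧ W.HasAdditiveReductionAt v)
    (hper₀ : ∀ [NeZero (W.conductorNorm ℤ)] (f : CuspForm (Gamma0 (W.conductorNorm ℤ)) 2),
      IsNewformOf W f → ∀ ϖ : ℚ, (ϖ : ℝ) * W.realPeriodRat = plusPeriod f → 0 ≤ padicValRat 2 ϖ)
    (hgo : GoodOrd W 2) (hgap : TowerGapAtTwo W) {n : ℕ}
    (hrank : ∀ (κ : ZpExtension ℚ 2) (γ : Field.absoluteGaloisGroup ℚ), κ.IsCyclotomic →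
      κ.IsTopGenerator γ → IsCyclotomicVariable 2 γ → ∀ D : W.SelmerDualData κ γ,
      ∃ j : ℕ, 2 ^ n ≤ Nat.card (D.X ⧸ (towerIdeal 2 j • ⊤ : Submodule (IwasawaAlgebra 2) D.X)))
    (hlan : AnalyticLambdaEq W 2 n) (hμan : AnalyticMuLE W 2 0) : MazurMainConjecture W 2 :=
  mazurMainConjecture_two_of_towerGap_of_lambda_le W h17 hper₀ hgo hgap hlan hμan
    (le_lambda_of_towerGap_of_towerRank_of_additive W h415 hadd hgap hrank)

/-- **The Kato–Néron half AT `W` (item `OrdKatoHalfAtTwo`, 19271, at this curve) with rational `2`-torsion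
allowed.** [cite: Kato2004Asterisque, Thm. 17.4 (1)(2) (p. 273)] [cite: GreenbergLNM1716, Prop. 4.15 (i) (§4)] -/
theorem katoHalfAt_two_of_towerGap_of_towerRank_of_additive
    (h17 : ∀ [NeZero (W.conductorNorm ℤ)] (f : CuspForm (Gamma0 (W.conductorNorm ℤ)) 2),
      kato_divisibility_allPrimes W 2 (f := f))
    (h415 : prop415i_noFiniteSubmodule_of_additive)
    (hadd : ∃ v : HeightOneSpectrum (𝓞 ℚ), ((2 : ℕ) : 𝓞 ℚ) ∉ v.asIdeal ∧ W.HasAdditiveReductionAt v)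
    (hper₀ : ∀ [NeZero (W.conductorNorm ℤ)] (f : CuspForm (Gamma0 (W.conductorNorm ℤ)) 2),
      IsNewformOf W f → ∀ ϖ : ℚ, (ϖ : ℝ) * W.realPeriodRat = plusPeriod f → 0 ≤ padicValRat 2 ϖ)
    (hgo : GoodOrd W 2) (hgap : TowerGapAtTwo W) {n : ℕ}
    (hrank : ∀ (κ : ZpExtension ℚ 2) (γ : Field.absoluteGaloisGroup ℚ), κ.IsCyclotomic →
      κ.IsTopGenerator γ → IsCyclotomicVariable 2 γ → ∀ D : W.SelmerDualData κ γ,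
      ∃ j : ℕ, 2 ^ n ≤ Nat.card (D.X ⧸ (towerIdeal 2 j • ⊤ : Submodule (IwasawaAlgebra 2) D.X)))
    (hlan : AnalyticLambdaEq W 2 n) (hμan : AnalyticMuLE W 2 0) :
    MainConjectureLowerDivisibilityAtTwoOrd W :=
  katoHalfAt_two_of_towerGap_of_lambda_le W h17 hper₀ hgo hgap hlan hμan
    (le_lambda_of_towerGap_of_towerRank_of_additive W h415 hadd hgap hrank)

/-- **Item `OrdKatoHalfAtTwoIso` (19573) AT `W` (witness `W` itself) with rational `2`-torsion allowed.**
[cite: Kato2004Asterisque, Thm. 17.4 (1)(2) (p. 273)] [cite: GreenbergLNM1716, Prop. 4.15 (i) (§4)] -/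
theorem exists_isIsogenous_katoHalfAt_two_of_towerGap_of_towerRank_of_additive
    (h17 : ∀ [NeZero (W.conductorNorm ℤ)] (f : CuspForm (Gamma0 (W.conductorNorm ℤ)) 2),
      kato_divisibility_allPrimes W 2 (f := f))
    (h415 : prop415i_noFiniteSubmodule_of_additive)
    (hadd : ∃ v : HeightOneSpectrum (𝓞 ℚ), ((2 : ℕ) : 𝓞 ℚ) ∉ v.asIdeal ∧ W.HasAdditiveReductionAt v)
    (hper₀ : ∀ [NeZero (W.conductorNorm ℤ)] (f : CuspForm (Gamma0 (W.conductorNorm ℤ)) 2),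
      IsNewformOf W f → ∀ ϖ : ℚ, (ϖ : ℝ) * W.realPeriodRat = plusPeriod f → 0 ≤ padicValRat 2 ϖ)
    (hgo : GoodOrd W 2) (hgap : TowerGapAtTwo W) {n : ℕ}
    (hrank : ∀ (κ : ZpExtension ℚ 2) (γ : Field.absoluteGaloisGroup ℚ), κ.IsCyclotomic →
      κ.IsTopGenerator γ → IsCyclotomicVariable 2 γ → ∀ D : W.SelmerDualData κ γ,
      ∃ j : ℕ, 2 ^ n ≤ Nat.card (D.X ⧸ (towerIdeal 2 j • ⊤ : Submodule (IwasawaAlgebra 2) D.X)))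
    (hlan : AnalyticLambdaEq W 2 n) (hμan : AnalyticMuLE W 2 0) :
    ∃ (W' : WeierstrassCurve ℚ) (_ : W'.IsElliptic) (_ : W'.IsGloballyMinimal),
      IsIsogenous W W' ∧ MainConjectureLowerDivisibilityAtTwoOrd W' :=
  ⟨W, inferInstance, inferInstance, IsIsogenous.refl_holds W,
    katoHalfAt_two_of_towerGap_of_towerRank_of_additive W h17 h415 hadd hper₀ hgo hgap hrank hlan hμan⟩

/-- **The Eisenstein half AT `W` with rational `2`-torsion allowed** (`MainConjectureEisensteinDivisibilityAtTwo W`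
from the tower certificates through the full IMC). [cite: Kato2004Asterisque, Thm. 17.4 (1)(2) (p. 273)]
[cite: GreenbergLNM1716, Prop. 4.15 (i) (§4)] -/
theorem eisensteinAt_two_of_towerGap_of_towerRank_of_additive
    (h17 : ∀ [NeZero (W.conductorNorm ℤ)] (f : CuspForm (Gamma0 (W.conductorNorm ℤ)) 2),
      kato_divisibility_allPrimes W 2 (f := f))
    (h415 : prop415i_noFiniteSubmodule_of_additive)
    (hadd : ∃ v : HeightOneSpectrum (𝓞 ℚ), ((2 : ℕ) : 𝓞 ℚ) ∉ v.asIdeal ∧ W.HasAdditiveReductionAt v)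
    (hper₀ : ∀ [NeZero (W.conductorNorm ℤ)] (f : CuspForm (Gamma0 (W.conductorNorm ℤ)) 2),
      IsNewformOf W f → ∀ ϖ : ℚ, (ϖ : ℝ) * W.realPeriodRat = plusPeriod f → 0 ≤ padicValRat 2 ϖ)
    (hgo : GoodOrd W 2) (hgap : TowerGapAtTwo W) {n : ℕ}
    (hrank : ∀ (κ : ZpExtension ℚ 2) (γ : Field.absoluteGaloisGroup ℚ), κ.IsCyclotomic →
      κ.IsTopGenerator γ → IsCyclotomicVariable 2 γ → ∀ D : W.SelmerDualData κ γ,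
      ∃ j : ℕ, 2 ^ n ≤ Nat.card (D.X ⧸ (towerIdeal 2 j • ⊤ : Submodule (IwasawaAlgebra 2) D.X)))
    (hlan : AnalyticLambdaEq W 2 n) (hμan : AnalyticMuLE W 2 0) :
    MainConjectureEisensteinDivisibilityAtTwo W :=
  eisensteinAt_two_of_towerGap_of_lambda_le W h17 hper₀ hgo hgap hlan hμan
    (le_lambda_of_towerGap_of_towerRank_of_additive W h415 hadd hgap hrank)

/-- **Door for `BSD(E,2)` at analytic rank `0` with rational `2`-torsion allowed and NO descent certificate:**
PRINT {modularity, GZK, Kato 17.4 (1)(2)@2, Greenberg Thm. 4.1@2 (`hEC`), Greenberg Prop. 4.15 (i)} + an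
additive place `v ∤ 2` + DISPLAYED `hper₀` + `GoodOrd W 2`, `r_an = 0` + certificates {`TowerGapAtTwo W`,
RANK `hrank`, `λ_an = n`, `μ_an = 0`} ⇒ `BSDp W 2`. [cite: GreenbergLNM1716, Thm. 4.1 (p. 102), Prop. 4.15 (i) (§4)]
[cite: Kato2004Asterisque, Thm. 17.4 (1)(2) (p. 273)] [cite: Miller2011LMS, Def. 1.1] -/
theorem bsdp_two_of_towerGap_of_towerRank_of_additive (hmod : nonempty_modularParametrizationData)
    (hGZK : rank_eq_analyticRank_of_analyticRank_le_one)
    (h17 : ∀ [NeZero (W.conductorNorm ℤ)] (f : CuspForm (Gamma0 (W.conductorNorm ℤ)) 2),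
      kato_divisibility_allPrimes W 2 (f := f))
    (hEC : TwoAdicEulerCharRankZero W 0) (h415 : prop415i_noFiniteSubmodule_of_additive)
    (hadd : ∃ v : HeightOneSpectrum (𝓞 ℚ), ((2 : ℕ) : 𝓞 ℚ) ∉ v.asIdeal ∧ W.HasAdditiveReductionAt v)
    (hper₀ : ∀ [NeZero (W.conductorNorm ℤ)] (f : CuspForm (Gamma0 (W.conductorNorm ℤ)) 2),
      IsNewformOf W f → ∀ ϖ : ℚ, (ϖ : ℝ) * W.realPeriodRat = plusPeriod f → 0 ≤ padicValRat 2 ϖ)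
    (hgo : GoodOrd W 2) (hr : W.analyticRank = 0) (hgap : TowerGapAtTwo W) {n : ℕ}
    (hrank : ∀ (κ : ZpExtension ℚ 2) (γ : Field.absoluteGaloisGroup ℚ), κ.IsCyclotomic →
      κ.IsTopGenerator γ → IsCyclotomicVariable 2 γ → ∀ D : W.SelmerDualData κ γ,
      ∃ j : ℕ, 2 ^ n ≤ Nat.card (D.X ⧸ (towerIdeal 2 j • ⊤ : Submodule (IwasawaAlgebra 2) D.X)))
    (hlan : AnalyticLambdaEq W 2 n) (hμan : AnalyticMuLE W 2 0) : BSDp W 2 :=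
  bsdp_two_of_towerGap_of_lambda_le W hmod hGZK h17 hEC hper₀ hgo hr hgap hlan hμan
    (le_lambda_of_towerGap_of_towerRank_of_additive W h415 hadd hgap hrank)

/-- **Item `OrdMissingLowerBoundAtTwo` (19577) AT `W` with rational `2`-torsion allowed and NO descent
certificate**: the descent inequality `ord₂ #Ш_an ≤ ord₂ #Ш` at the curve through the Eisenstein half at `2`
(X5 door `O1.missingLowerBoundAt_two_of_eisenstein_of_kato`). [cite: GreenbergLNM1716, Thm. 4.1 (p. 102), Prop. 4.15 (i) (§4)]
[cite: Kato2004Asterisque, Thm. 17.4 (1)(2) (p. 273)] -/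
theorem missingLowerBoundAt_two_of_towerGap_of_towerRank_of_additive (hmod : nonempty_modularParametrizationData)
    (hGZK : rank_eq_analyticRank_of_analyticRank_le_one)
    (h17 : ∀ [NeZero (W.conductorNorm ℤ)] (f : CuspForm (Gamma0 (W.conductorNorm ℤ)) 2),
      kato_divisibility_allPrimes W 2 (f := f))
    (hEC : TwoAdicEulerCharRankZero W 0) (h415 : prop415i_noFiniteSubmodule_of_additive)
    (hadd : ∃ v : HeightOneSpectrum (𝓞 ℚ), ((2 : ℕ) : 𝓞 ℚ) ∉ v.asIdeal ∧ W.HasAdditiveReductionAt v)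
    (hper₀ : ∀ [NeZero (W.conductorNorm ℤ)] (f : CuspForm (Gamma0 (W.conductorNorm ℤ)) 2),
      IsNewformOf W f → ∀ ϖ : ℚ, (ϖ : ℝ) * W.realPeriodRat = plusPeriod f → 0 ≤ padicValRat 2 ϖ)
    (hgo : GoodOrd W 2) (hr : W.analyticRank = 0) (hgap : TowerGapAtTwo W) {n : ℕ}
    (hrank : ∀ (κ : ZpExtension ℚ 2) (γ : Field.absoluteGaloisGroup ℚ), κ.IsCyclotomic →
      κ.IsTopGenerator γ → IsCyclotomicVariable 2 γ → ∀ D : W.SelmerDualData κ γ,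
      ∃ j : ℕ, 2 ^ n ≤ Nat.card (D.X ⧸ (towerIdeal 2 j • ⊤ : Submodule (IwasawaAlgebra 2) D.X)))
    (hlan : AnalyticLambdaEq W 2 n) (hμan : AnalyticMuLE W 2 0) : MissingLowerBoundAt W 2 :=
  missingLowerBoundAt_two_of_eisenstein_of_kato W hEC hmod hGZK h17 hr hgo
    (eisensteinAt_two_of_towerGap_of_towerRank_of_additive W h17 h415 hadd hper₀ hgo hgap hrank hlan hμan)

end Summit.BirchSwinnertonDyer.BirchSwinnertonDyer.Theorems.TowerLambdaTorsion

/-! ## §4 An additive place off an integer model (the `hadd` input of §1–§3 per class) -/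

namespace Summit.BirchSwinnertonDyer.BirchSwinnertonDyer.Theorems.TowerClass

open Rat.HeightOneSpectrum Literature.NumberTheory.GaloisRepresentations
  Summit.BirchSwinnertonDyer.BirchSwinnertonDyer.Theorems.TowerLambdaTorsion

section Places

/-- `v(n) ≤ exp(−e)` ⇒ `ℓ^e ∣ n` for an integer `n` at the place of `ℚ` over `ℓ` (`v = (ℓ)` in `𝓞 ℚ ≅ ℤ`).
[folklore] -/
theorem pow_dvd_of_valuation_intCast_le (v : HeightOneSpectrum (𝓞 ℚ)) {n : ℤ} {e : ℕ}
    (h : v.valuation ℚ (n : ℚ) ≤ WithZero.exp (-(e : ℤ))) : (natGenerator v : ℤ) ^ e ∣ n := by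
  rw [Rat.valuation_intCast, HeightOneSpectrum.intValuation_le_pow_iff_mem, Rat.asIdeal_eq_span_natGenerator,
    Ideal.span_singleton_pow, Ideal.mem_span_singleton] at h
  have h' := map_dvd (Rat.IsIntegralClosure.intEquiv (𝓞 ℚ)) h
  simpa using h'

variable (M : WeierstrassCurve ℤ)

/-- **Additive reduction of an integer model at a place over `ℓ ∣ Δ`, `ℓ ∣ c₄`, `ℓ⁴ ∤ c₄`** (`𝓞 ℚ`-place
currency): the equation is integral with `0 < ord_ℓ c₄ < 4`, hence minimal at `ℓ` (Silverman VII.1 Rem. 1.1),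
and `ord_ℓ Δ > 0`, `ord_ℓ c₄ > 0` is additive reduction (VII.5 Prop. 5.1 (c); tree
`hasAdditiveReductionAt_of_lt_valuation_c₄`). [cite: SilvermanAEC2009, VII.5 Prop. 5.1 (c) and VII.1 Remark 1.1] -/
theorem hasAdditiveReductionAt_intModel (v : HeightOneSpectrum (𝓞 ℚ)) [(M.baseChange ℚ).IsElliptic]
    (hΔ : (natGenerator v : ℤ) ∣ M.Δ) (hc₄ : (natGenerator v : ℤ) ∣ M.c₄)
    (h4 : ¬ (natGenerator v : ℤ) ^ 4 ∣ M.c₄) : (M.baseChange ℚ).HasAdditiveReductionAt v := by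
  have hlt1 : WithZero.exp (-(1 : ℕ) : ℤ) < (1 : WithZero (Multiplicative ℤ)) := by
    rw [← WithZero.exp_zero, WithZero.exp_lt_exp]; norm_num
  refine hasAdditiveReductionAt_of_lt_valuation_c₄ (isIntegralAt_baseChange_intModel M v) ?_ ?_ ?_
  · rw [baseChange_int_c₄]
    exact not_le.mp fun h => h4 (pow_dvd_of_valuation_intCast_le v h)
  · rw [baseChange_int_c₄]
    exact lt_of_le_of_lt (Rat.valuation_intCast_le v (e := 1) (by simpa using hc₄)) hlt1
  · rw [baseChange_int_Δ]
    exact lt_of_le_of_lt (Rat.valuation_intCast_le v (e := 1) (by simpa using hΔ)) hlt1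

/-- An additive place of an integer model OFF `2`, packaged as the hypothesis of the `_of_additive` doors:
an odd prime `ℓ` with `ℓ ∣ Δ`, `ℓ ∣ c₄`, `ℓ⁴ ∤ c₄`. [cite: SilvermanAEC2009, VII.5 Prop. 5.1 (c) and VII.1 Remark 1.1] -/
theorem exists_additivePlace_intModel [(M.baseChange ℚ).IsElliptic] (ℓ : ℕ) (hℓ : ℓ.Prime) (hℓ2 : ℓ ≠ 2)
    (hΔ : (ℓ : ℤ) ∣ M.Δ) (hc₄ : (ℓ : ℤ) ∣ M.c₄) (h4 : ¬ (ℓ : ℤ) ^ 4 ∣ M.c₄) :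
    ∃ v : HeightOneSpectrum (𝓞 ℚ), ((2 : ℕ) : 𝓞 ℚ) ∉ v.asIdeal ∧ (M.baseChange ℚ).HasAdditiveReductionAt v := by
  set v : HeightOneSpectrum (𝓞 ℚ) := (primesEquiv (R := 𝓞 ℚ)).symm ⟨ℓ, hℓ⟩ with hv
  have hgen : natGenerator v = ℓ := congrArg Subtype.val ((primesEquiv (R := 𝓞 ℚ)).apply_symm_apply ⟨ℓ, hℓ⟩)
  refine ⟨v, two_notMem_asIdeal_of_natGenerator_ne v (by rw [hgen]; exact hℓ2), ?_⟩
  exact hasAdditiveReductionAt_intModel M v (by rw [hgen]; exact hΔ) (by rw [hgen]; exact hc₄)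
    (by rw [hgen]; exact h4)

end Places

end Summit.BirchSwinnertonDyer.BirchSwinnertonDyer.Theorems.TowerClass

end
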